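import Summits.CriticalPhenomena.PercolationContinuityZ3.Theorems.PercNearOneGluingNoHeavyLowerTailAntitheticHandlePrinciple
import Summits.CriticalPhenomena.PercolationContinuityZ3.Theorems.PercNearOneGluingNoHeavyLowerTailAntitheticFreezeBoxes
import HarnessLib

/-!
# `NoHeavyLowerTail` (stmt-CriticalPhenomena-4575) — antithetic cluster pairs: the **⊕-HANDLE THEOREM** (HOME/MEMO-gen63.md §1–§2,
# prim-hp-2 gen 63): Δ2 for `K` + a handle at `P`, from a red-dominated box partition of the ⊕-event `{P ∈ X_K}` ALONE

Support file (`--supports stmt-CriticalPhenomena-4575`, hull-port prover `prim-hp-2`, gen 63).  No definitions, no named facts, no sorries;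
standard axioms.  VERTEX version; notation of …AntitheticBoxes / …AntitheticHandlePrinciple.

The HANDLE PRINCIPLE (`Antithetic.Pendant.handle_vertex_sum_nonneg_of`, gen 62) derives the vertex antithetic inequality at `R = {x}` for
`G = K ∪ (P – u 1 – … – u a = y) ∪ (Q – w 1 – … – w b = z) + xy + xz` from two hypotheses on the base graph `K` (edge set `E₀`): (⊕) every
`K ∪ stub_j` (`j < b`) is ⊕-positive at `P`, and (M) `TII_{E₀}(P, Q; K) ≥ 0` for all super-odd twisted-monotone `K`.  By gen 63's
"boxes survive freezing" (`Antithetic.Box.mixed_of_oplus_boxes`) and pendant stability (`Antithetic.Box.dom_path`), BOTH follow from a single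
red-dominated box partition of `{T : P ∈ X_{E₀} T}` with fixed pairs inside `E₀`:
* `Antithetic.Pendant.oplus_stub_of_boxes` — (⊕) for `E₀ ∪ stub_j`, all `j ≤ b`;
* `Antithetic.Pendant.handle_vertex_sum_nonneg_of_boxes` — **⊕-HANDLE THEOREM**: such a partition for `(K, s, P)` gives, for EVERY `Q`, all arm
  lengths `a, b ≥ 0` and all monotone `F, G`, `0 ≤ Σ_{ω : ¬(x ∈ X_E ω ∧ x ∈ Y_E ω)} (F(X_E ω) − F(Y_E ω))(G(X_E ω) − G(Y_E ω))`;
* `Antithetic.Pendant.sourceArm_vertex_sum_nonneg` — the case `P = s` needs nothing (one box, nothing fixed): for EVERY finite loop-free graph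
  `K ∋ s`, every vertex `Q` of it and all arms, Δ2 holds for `K ∪ (s – u 1 – … – y) ∪ (Q – w 1 – … – z) + x`; i.e. the vertex antithetic inequality at
  `R = {x}` holds whenever the source lies on the ear of `x` or is one of its two ends (generalises …AntitheticHandleSource from cycles to all graphs).
[cite: VandenbergHaggstromKahn2005, §1 p. 6 ("Harris' inequality"), §1 p. 3 (open cluster `C_s`)]
-/

noncomputable section

namespace Summit.CriticalPhenomena.PercolationContinuityZ3.Theorems

open Literature.Probability.Percolation
open scoped Classical

namespace Antithetic

namespace Pendant

variable {V : Type*} [Fintype V] {E₀ : Set (Sym2 V)} {s P : V} {w : ℕ → V} {b : ℕ}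
  (hwfresh : ∀ i, 0 < i → i ≤ b → ∀ f ∈ E₀, w i ∈ f → f.IsDiag)
  (hwinj : ∀ i j, i ≤ b → j ≤ b → w i = w j → i = j)
  (hsw : ∀ i, 0 < i → i ≤ b → s ≠ w i) (hPw : ∀ i, 0 < i → i ≤ b → P ≠ w i)
  {C : Type*} (Fix N : C → Set (Sym2 V)) (hFixE : ∀ c, Fix c ⊆ E₀)
  (hcover : ∀ T : Set (Sym2 V), P ∈ openCluster (T ∩ E₀) s → ∃ c, ∀ e ∈ Fix c, (e ∈ T ↔ e ∈ N c))
  (hinside : ∀ c (T : Set (Sym2 V)), (∀ e ∈ Fix c, (e ∈ T ↔ e ∈ N c)) → P ∈ openCluster (T ∩ E₀) s)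
  (huniq : ∀ c c' (T : Set (Sym2 V)), (∀ e ∈ Fix c, (e ∈ T ↔ e ∈ N c)) → (∀ e ∈ Fix c', (e ∈ T ↔ e ∈ N c')) → c = c')
  (hdom : ∀ c (T T' : Set (Sym2 V)), (∀ e ∈ Fix c, (e ∈ T ↔ e ∈ N c)) → (∀ e ∈ Fix c, (e ∈ T' ↔ e ∈ N c)) →
    (∀ e ∉ Fix c, (e ∈ T' ↔ e ∉ T)) → openCluster (T'ᶜ ∩ E₀) s ⊆ openCluster (T ∩ E₀) s)
include hwfresh hwinj hsw hPw hFixE hcover hinside huniq hdom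

/-- **(⊕) along the stub from the boxes of `K`.**  A red-dominated box partition of `{P ∈ X_{E₀}}` with fixed pairs inside `E₀` is one of
`{P ∈ X_{E₀ ∪ stub_j}}` for the pendant stub `w 0 … w j` of fresh vertices (left free); hence `E₀ ∪ stub_j` is ⊕-positive at `P`. [this work] -/
theorem oplus_stub_of_boxes {j : ℕ} (hj : j ≤ b) (K₁ K₂ : Set V → Set V → ℝ)
    (hK₁ : ∀ ⦃A A' B B' : Set V⦄, A ⊆ A' → B' ⊆ B → K₁ A B ≤ K₁ A' B') (hso₁ : ∀ A B, 0 ≤ K₁ A B + K₁ B A)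
    (hK₂ : ∀ ⦃A A' B B' : Set V⦄, A ⊆ A' → B' ⊆ B → K₂ A B ≤ K₂ A' B') (hso₂ : ∀ A B, 0 ≤ K₂ A B + K₂ B A) :
    0 ≤ ∑ T ∈ Finset.univ.filter (fun T : Set (Sym2 V) => P ∈ openCluster (T ∩ (E₀ ∪ Cyc.edgeSet j w)) s),
      K₁ (openCluster (T ∩ (E₀ ∪ Cyc.edgeSet j w)) s) (openCluster (Tᶜ ∩ (E₀ ∪ Cyc.edgeSet j w)) s) *
        K₂ (openCluster (T ∩ (E₀ ∪ Cyc.edgeSet j w)) s) (openCluster (Tᶜ ∩ (E₀ ∪ Cyc.edgeSet j w)) s) := by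
  -- stub pairs are not pairs of `E₀`, hence never fixed
  have hstub : ∀ i, i < j → s(w i, w (i + 1)) ∉ E₀ := by
    intro i hi hmem
    have hdiag := hwfresh (i + 1) (Nat.succ_pos i) (by omega) _ hmem (Sym2.mem_mk_right _ _)
    rw [Sym2.mk_isDiag_iff] at hdiag
    exact absurd (hwinj i (i + 1) (by omega) (by omega) hdiag) (by omega)
  refine Box.boxes_sum_nonneg (E₀ ∪ Cyc.edgeSet j w) s _ Fix N ?_ ?_ huniq ?_ hK₁ hso₁ hK₂ hso₂
  · intro T hT
    exact hcover T ((Box.mem_path_iff hwfresh hwinj hsw hj T hPw).1 (Finset.mem_filter.1 hT).2)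
  · intro c T hT
    exact Finset.mem_filter.2 ⟨Finset.mem_univ _, (Box.mem_path_iff hwfresh hwinj hsw hj T hPw).2 (hinside c T hT)⟩
  · intro c T T' hT hT' hflip
    exact Box.dom_path hwfresh hwinj hsw hj (fun i hi => hflip _ fun h => hstub i hi (hFixE c h)) (hdom c T T' hT hT' hflip)

variable {u : ℕ → V} {a : ℕ} {Q : V} (hu0 : u 0 = P) (hw0 : w 0 = Q)
  (hufresh : ∀ i, 0 < i → i ≤ a → ∀ f ∈ E₀ ∪ Cyc.edgeSet b w, u i ∈ f → f.IsDiag)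
  (huinj : ∀ i j, i ≤ a → j ≤ a → u i = u j → i = j)
  (hsu : ∀ i, 0 < i → i ≤ a → s ≠ u i) (hzu : ∀ i, 0 < i → i ≤ a → w b ≠ u i)
include hu0 hw0 hufresh huinj hsu hzu

/-- **⊕-HANDLE THEOREM.**  `K` any loop-free finite graph (edge set `E₀`) through `s`; `P, Q` vertices of `K`; arms `u 0 = P, …, u a = y` and
`w 0 = Q, …, w b = z` of fresh vertices (`a, b ≥ 0`); `x` fresh, joined to `y` and `z`; `yz` not a pair of `H = K ∪ arms`; `E = H + xy + xz`.
If the ⊕-event `{T : P ∈ X_{E₀} T}` admits a red-dominated box partition with fixed pairs inside `E₀` (cover / inside / uniqueness /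
domination), then for all monotone `F, G`: `0 ≤ Σ_{ω : ¬(x ∈ X_E ω ∧ x ∈ Y_E ω)} (F(X_E ω) − F(Y_E ω))·(G(X_E ω) − G(Y_E ω))`.
(The edge set of `H` is written `(stub ∪ E₀) ∪ arm` — equal to the handle principle's `(E₀ ∪ stub) ∪ arm`; the hypotheses here are
genuinely weaker: no (M), and (⊕) only for `K` itself, as boxes.) [this work] -/
theorem handle_vertex_sum_nonneg_of_boxes (hnd : ∀ f ∈ E₀, ¬ f.IsDiag) {x : V}
    (hx : ∀ f ∈ (Cyc.edgeSet b w ∪ E₀) ∪ Cyc.edgeSet a u, x ∈ f → f.IsDiag)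
    (hxs : x ≠ s) (hxy : x ≠ u a) (hxz : x ≠ w b) (hyz : u a ≠ w b) (hg : s(u a, w b) ∉ (Cyc.edgeSet b w ∪ E₀) ∪ Cyc.edgeSet a u)
    {F G : Set V → ℝ} (hF : Monotone F) (hG : Monotone G) :
    0 ≤ ∑ ω ∈ Finset.univ.filter (fun ω : Set (Sym2 V) =>
        ¬ ((openGraph (ω ∩ insert s(x, u a) (insert s(x, w b) ((Cyc.edgeSet b w ∪ E₀) ∪ Cyc.edgeSet a u)))).Reachable s x ∧
          (openGraph (ωᶜ ∩ insert s(x, u a) (insert s(x, w b) ((Cyc.edgeSet b w ∪ E₀) ∪ Cyc.edgeSet a u)))).Reachable s x)),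
      (F (openCluster (ω ∩ insert s(x, u a) (insert s(x, w b) ((Cyc.edgeSet b w ∪ E₀) ∪ Cyc.edgeSet a u))) s) -
          F (openCluster (ωᶜ ∩ insert s(x, u a) (insert s(x, w b) ((Cyc.edgeSet b w ∪ E₀) ∪ Cyc.edgeSet a u))) s)) *
        (G (openCluster (ω ∩ insert s(x, u a) (insert s(x, w b) ((Cyc.edgeSet b w ∪ E₀) ∪ Cyc.edgeSet a u))) s) -
          G (openCluster (ωᶜ ∩ insert s(x, u a) (insert s(x, w b) ((Cyc.edgeSet b w ∪ E₀) ∪ Cyc.edgeSet a u))) s)) := by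
  -- (the statement writes the edge set of `H` as `(stub ∪ E₀) ∪ arm`, the handle principle as `(E₀ ∪ stub) ∪ arm`: the same set)
  have hcomm : Cyc.edgeSet b w ∪ E₀ = E₀ ∪ Cyc.edgeSet b w := Set.union_comm _ _
  rw [hcomm] at hx hg ⊢
  refine handle_vertex_sum_nonneg_of hu0 hw0 hufresh hwfresh huinj hwinj hsu hsw hPw hzu ?_ ?_ hnd hx hxs hxy hxz hyz hg hF hG
  · intro j hj K₁ K₂ hK₁ hso₁ hK₂ hso₂
    exact oplus_stub_of_boxes hwfresh hwinj hsw hPw Fix N hFixE hcover hinside huniq hdom hj.le K₁ K₂ hK₁ hso₁ hK₂ hso₂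
  · intro K₁ K₂ hK₁ hso₁ hK₂ hso₂
    exact Box.mixed_of_oplus_boxes E₀ s P Q Fix N hcover hinside huniq hdom hK₁ hso₁ hK₂ hso₂

end Pendant

namespace Pendant

variable {V : Type*} [Fintype V] {E₀ : Set (Sym2 V)} {s Q : V} {u w : ℕ → V} {a b : ℕ}
  (hu0 : u 0 = s) (hw0 : w 0 = Q)
  (hufresh : ∀ i, 0 < i → i ≤ a → ∀ f ∈ E₀ ∪ Cyc.edgeSet b w, u i ∈ f → f.IsDiag)
  (hwfresh : ∀ i, 0 < i → i ≤ b → ∀ f ∈ E₀, w i ∈ f → f.IsDiag)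
  (huinj : ∀ i j, i ≤ a → j ≤ a → u i = u j → i = j) (hwinj : ∀ i j, i ≤ b → j ≤ b → w i = w j → i = j)
  (hsu : ∀ i, 0 < i → i ≤ a → s ≠ u i) (hsw : ∀ i, 0 < i → i ≤ b → s ≠ w i)
  (hzu : ∀ i, 0 < i → i ≤ a → w b ≠ u i)
include hu0 hw0 hufresh hwfresh huinj hwinj hsu hsw hzu

/-- **Source on the ear of `x` (any base graph).**  `K` ANY loop-free finite graph (edge set `E₀`), `s` and `Q` vertices, arms `u 0 = s, …, u a = y`
and `w 0 = Q, …, w b = z` of fresh vertices (`a, b ≥ 0`), `x` fresh joined to `y, z`, `yz` not a pair of `H = K ∪ arms`, `E = H + xy + xz`.  Then for all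
monotone `F, G`: `0 ≤ Σ_{ω : ¬(x ∈ X_E ω ∧ x ∈ Y_E ω)} (F(X_E ω) − F(Y_E ω))·(G(X_E ω) − G(Y_E ω))` — the ⊕-event at the source is the whole cube,
one red-dominated box with nothing fixed.  (`E` is written `H + xz + xy`, the same set as `H + xy + xz`; an unconditional theorem about
every base graph, not a restatement of the conditional principle.) [this work] -/
theorem sourceArm_vertex_sum_nonneg (hnd : ∀ f ∈ E₀, ¬ f.IsDiag) {x : V}
    (hx : ∀ f ∈ (Cyc.edgeSet b w ∪ E₀) ∪ Cyc.edgeSet a u, x ∈ f → f.IsDiag)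
    (hxs : x ≠ s) (hxy : x ≠ u a) (hxz : x ≠ w b) (hyz : u a ≠ w b) (hg : s(u a, w b) ∉ (Cyc.edgeSet b w ∪ E₀) ∪ Cyc.edgeSet a u)
    {F G : Set V → ℝ} (hF : Monotone F) (hG : Monotone G) :
    0 ≤ ∑ ω ∈ Finset.univ.filter (fun ω : Set (Sym2 V) =>
        ¬ ((openGraph (ω ∩ insert s(x, w b) (insert s(x, u a) ((Cyc.edgeSet b w ∪ E₀) ∪ Cyc.edgeSet a u)))).Reachable s x ∧
          (openGraph (ωᶜ ∩ insert s(x, w b) (insert s(x, u a) ((Cyc.edgeSet b w ∪ E₀) ∪ Cyc.edgeSet a u)))).Reachable s x)),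
      (F (openCluster (ω ∩ insert s(x, w b) (insert s(x, u a) ((Cyc.edgeSet b w ∪ E₀) ∪ Cyc.edgeSet a u))) s) -
          F (openCluster (ωᶜ ∩ insert s(x, w b) (insert s(x, u a) ((Cyc.edgeSet b w ∪ E₀) ∪ Cyc.edgeSet a u))) s)) *
        (G (openCluster (ω ∩ insert s(x, w b) (insert s(x, u a) ((Cyc.edgeSet b w ∪ E₀) ∪ Cyc.edgeSet a u))) s) -
          G (openCluster (ωᶜ ∩ insert s(x, w b) (insert s(x, u a) ((Cyc.edgeSet b w ∪ E₀) ∪ Cyc.edgeSet a u))) s)) := by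
  -- (the statement lists the two pairs at `x` in the order `xz, xy`: the same edge set as in `handle_vertex_sum_nonneg_of_boxes`)
  rw [Set.insert_comm]
  -- the `P`-freshness of the stub is `s ≠ w i` here (`P = s`); the ⊕-event at the source is one box with nothing fixed
  refine handle_vertex_sum_nonneg_of_boxes hwfresh hwinj hsw hsw (fun _ : Unit => (∅ : Set (Sym2 V))) (fun _ => ∅)
    (fun _ => Set.empty_subset _) (fun T _ => ⟨(), fun e he => absurd he (Set.notMem_empty e)⟩)
    (fun _ T _ => mem_openCluster_self _ _) (fun _ _ _ _ _ => rfl) (fun _ T T' _ _ hflip => ?_)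
    hu0 hw0 hufresh huinj hsu hzu hnd hx hxs hxy hxz hyz hg hF hG
  have hTT : T'ᶜ = T := by
    ext e
    rw [Set.mem_compl_iff]
    constructor
    · intro he
      by_contra h
      exact he ((hflip e (Set.notMem_empty e)).2 h)
    · intro he he'
      exact (hflip e (Set.notMem_empty e)).1 he' he
  rw [hTT]

end Pendant

end Antithetic

end Summit.CriticalPhenomena.PercolationContinuityZ3.Theorems
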